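import Literature.NumberTheory.Transcendental.PhilipponZeroEstimateStd
import Literature.NumberTheory.Transcendental.ProjectiveSpace
import Mathlib.Analysis.Analytic.Order
import HarnessLib

/-!
# Orders of vanishing along lines: transfer through a non-vanishing factor, and charts

Topic: `Literature/NumberTheory/Transcendental`. Two elementary reductions used when the
vanishing conditions `GaGmE.Std.VanishesAlong 𝔟 F_P (s·v) N` of Philippon's zero estimate
(`PhilipponZeroEstimateStd.lean`) are turned into algebraic linear conditions (Siegel step) or
algebraic numbers (Liouville step) in Baker's method on `M_κ` (plan item W4 of the unit
`provefact-Literature.NumberTheory.Transcendental.H-b596640137`). Both are PROVED: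

* `forall_iteratedDeriv_mul_eq_zero_iff` — **order transfer**: if `g` is analytic and non-zero at
  `c`, then `g·f` vanishes to order `≥ N` at `c` iff `f` does (additivity of `analyticOrderAt`);
* `GaGmE.Std.thetaEval_eq_pow_mul_eval_chart` — **dehomogenisation in a chart**: for a form `P` of
  degree `D` and an index `J₀` with `Θ_{J₀}(w) ≠ 0`,
  `F_P(w) = Θ_{J₀}(w)^D · P(Θ_J(w)/Θ_{J₀}(w))_J` (homogeneity), so that along a line on which
  `Θ_{J₀}` does not vanish the order of `F_P` equals the order of the polynomial `P` in the affine
  chart coordinates `A_J = Θ_J/Θ_{J₀}` — which are polynomial in the chart generators of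
  `UnivExtChartLattice.lean` / `UnivExtChartTheta.lean` and hence have polynomial jets
  (`PolyODEJets.lean`);
* `GaGmE.Std.vanishesAlong_thetaEval_iff_chart` — the combination: `VanishesAlong 𝔟 F_P w N` iff,
  for every direction `x ∈ 𝔟`, the chart expression `ξ ↦ P(A(w + ξx))` vanishes to order `≥ N`.

## References

* A. Baker, G. Wüstholz, *Logarithmic Forms and Diophantine Geometry*, CUP 2007, §6.8 (p. 119:
  `f_i(sv) = ϱ X_i(sγ)`, `Ψ(s) = ϱ^δ ξ`).
* P. Philippon, *Lemmes de zéros dans les groupes algébriques commutatifs*, Bull. SMF 114 (1986),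
  §2 (the order `ord_g P` through an affine representative `ψ`).
-/

noncomputable section

open Complex Filter Topology
open scoped PeriodPair

namespace Literature.NumberTheory.Transcendental

/-! ### Order transfer through a non-vanishing analytic factor -/

/-- **Order transfer.** If `f, g` are analytic at `c` and `g(c) ≠ 0`, then all derivatives of
order `< N` of `g·f` vanish at `c` iff those of `f` do (the analytic order is additive and the
order of `g` is `0`). [folklore] -/
theorem forall_iteratedDeriv_mul_eq_zero_iff {f g : ℂ → ℂ} {c : ℂ} (hf : AnalyticAt ℂ f c)
    (hg : AnalyticAt ℂ g c) (hg0 : g c ≠ 0) (N : ℕ) :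
    (∀ k < N, iteratedDeriv k (fun z => g z * f z) c = 0) ↔ ∀ k < N, iteratedDeriv k f c = 0 := by
  have hgf : AnalyticAt ℂ (fun z => g z * f z) c := hg.mul hf
  rw [← natCast_le_analyticOrderAt_iff_iteratedDeriv_eq_zero hgf,
    ← natCast_le_analyticOrderAt_iff_iteratedDeriv_eq_zero hf]
  have hmul : analyticOrderAt (fun z => g z * f z) c = analyticOrderAt g c + analyticOrderAt f c :=
    analyticOrderAt_mul hg hf
  rw [hmul, (hg.analyticOrderAt_eq_zero).mpr hg0, zero_add]

namespace GaGmE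

namespace Std

variable {β γ δ : Type} [Fintype β] [Fintype γ] [Fintype δ] [DecidableEq γ]
variable (L : PeriodPair) (κM : δ → γ → Kbar)

/-! ### Dehomogenisation of a form in a chart -/

/-- The affine chart coordinates `A_J = Θ_J/Θ_{J₀}` of `M_κ` at points where `Θ_{J₀} ≠ 0`.
[folklore] -/
def chartCoord (J₀ J : Option β × ThetaIdx γ δ) (w : β ⊕ (γ ⊕ δ) → ℂ) : ℂ :=
  theta L κM J w / theta L κM J₀ w

omit [Fintype β] [Fintype δ] in
/-- `A_{J₀} = 1` where `Θ_{J₀} ≠ 0`. [folklore] -/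
theorem chartCoord_self {J₀ : Option β × ThetaIdx γ δ} {w : β ⊕ (γ ⊕ δ) → ℂ}
    (h : theta L κM J₀ w ≠ 0) : chartCoord L κM J₀ J₀ w = 1 :=
  div_self h

omit [Fintype β] [Fintype δ] in
/-- **Dehomogenisation.** For a form `P` of degree `D` and a chart index `J₀` with
`Θ_{J₀}(w) ≠ 0`: `F_P(w) = Θ_{J₀}(w)^D · P(A(w))`, `A_J = Θ_J/Θ_{J₀}`. [folklore] -/
theorem thetaEval_eq_pow_mul_eval_chart {P : MvPolynomial (Option β × ThetaIdx γ δ) ℂ} {D : ℕ}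
    (hP : P.IsHomogeneous D) (J₀ : Option β × ThetaIdx γ δ) {w : β ⊕ (γ ⊕ δ) → ℂ}
    (h : theta L κM J₀ w ≠ 0) :
    thetaEval L κM P w = theta L κM J₀ w ^ D * MvPolynomial.eval (fun J => chartCoord L κM J₀ J w) P := by
  have e : (fun J => theta L κM J w) = theta L κM J₀ w • fun J => chartCoord L κM J₀ J w := by
    funext J
    simp [chartCoord, mul_div_cancel₀ _ h]
  rw [thetaEval, e, Projectivization.eval_smul_of_isHomogeneous hP]

/-! ### Vanishing along `𝔟` in chart terms -/

/-- The theta functions are analytic along every complex line in `Lie M_κ,ℂ`. [folklore] -/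
theorem analyticAt_theta_line (J : Option β × ThetaIdx γ δ) (w x : β ⊕ (γ ⊕ δ) → ℂ) (ξ₀ : ℂ) :
    AnalyticAt ℂ (fun ξ : ℂ => theta L κM J (w + ξ • x)) ξ₀ := by
  have hd : Differentiable ℂ (fun ξ : ℂ => theta L κM J (w + ξ • x)) :=
    (differentiable_theta L κM J).comp ((differentiable_const w).add (differentiable_id.smul_const x))
  exact hd.analyticAt ξ₀

/-- `F_P` is analytic along every complex line. [folklore] -/
theorem analyticAt_thetaEval_line (P : MvPolynomial (Option β × ThetaIdx γ δ) ℂ)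
    (w x : β ⊕ (γ ⊕ δ) → ℂ) (ξ₀ : ℂ) :
    AnalyticAt ℂ (fun ξ : ℂ => thetaEval L κM P (w + ξ • x)) ξ₀ := by
  unfold thetaEval
  induction P using MvPolynomial.induction_on with
  | C a => simpa using analyticAt_const
  | add p q hp hq =>
    simp only [map_add]
    exact hp.add hq
  | mul_X p J hp =>
    simp only [map_mul, MvPolynomial.eval_X]
    exact hp.mul (analyticAt_theta_line L κM J w x ξ₀)

/-- The chart expression `ξ ↦ P(A(w + ξx))` is analytic near `ξ = 0` when `Θ_{J₀}(w) ≠ 0`.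
[folklore] -/
theorem analyticAt_eval_chart_line (P : MvPolynomial (Option β × ThetaIdx γ δ) ℂ)
    (J₀ : Option β × ThetaIdx γ δ) (w x : β ⊕ (γ ⊕ δ) → ℂ) {ξ₀ : ℂ}
    (h : theta L κM J₀ (w + ξ₀ • x) ≠ 0) :
    AnalyticAt ℂ (fun ξ : ℂ => MvPolynomial.eval (fun J => chartCoord L κM J₀ J (w + ξ • x)) P) ξ₀ := by
  induction P using MvPolynomial.induction_on with
  | C a => simpa using analyticAt_const
  | add p q hp hq =>
    simp only [map_add]
    exact hp.add hq
  | mul_X p J hp =>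
    have hJ : AnalyticAt ℂ (fun ξ : ℂ => chartCoord L κM J₀ J (w + ξ • x)) ξ₀ :=
      (analyticAt_theta_line L κM J w x ξ₀).div (analyticAt_theta_line L κM J₀ w x ξ₀) h
    simp only [map_mul, MvPolynomial.eval_X]
    exact hp.mul hJ

/-- **Vanishing along `𝔟` in a chart.** For a form `P` of degree `D` and a chart index `J₀` with
`Θ_{J₀}(w) ≠ 0`: `F_P` vanishes to order `≥ N` at `w` along `𝔟` iff, for every `x ∈ 𝔟`, the chart
expression `ξ ↦ P(A(w + ξx))` vanishes to order `≥ N` at `ξ = 0` (order transfer through the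
non-vanishing factor `Θ_{J₀}(w + ξx)^D`). [cite: BakerWustholz2007, §6.8 (p. 119, Ψ(s) = ϱ^δ ξ)] -/
theorem vanishesAlong_thetaEval_iff_chart {P : MvPolynomial (Option β × ThetaIdx γ δ) ℂ} {D : ℕ}
    (hP : P.IsHomogeneous D) (J₀ : Option β × ThetaIdx γ δ) (𝔟 : Submodule ℂ (β ⊕ (γ ⊕ δ) → ℂ))
    {w : β ⊕ (γ ⊕ δ) → ℂ} (h : theta L κM J₀ w ≠ 0) (N : ℕ) :
    VanishesAlong 𝔟 (thetaEval L κM P) w N ↔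
      ∀ x ∈ 𝔟, ∀ k < N,
        iteratedDeriv k (fun ξ : ℂ => MvPolynomial.eval (fun J => chartCoord L κM J₀ J (w + ξ • x)) P) 0 = 0 := by
  refine forall₂_congr fun x _ => ?_
  have h0 : theta L κM J₀ (w + (0 : ℂ) • x) ≠ 0 := by simpa using h
  -- near `ξ = 0`, `Θ_{J₀}(w + ξx) ≠ 0` and the dehomogenisation holds
  have hnear : ∀ᶠ ξ in 𝓝 (0 : ℂ), theta L κM J₀ (w + ξ • x) ≠ 0 :=
    (analyticAt_theta_line L κM J₀ w x 0).continuousAt.eventually_ne h0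
  have heq : (fun ξ : ℂ => thetaEval L κM P (w + ξ • x)) =ᶠ[𝓝 0]
      fun ξ : ℂ => theta L κM J₀ (w + ξ • x) ^ D *
        MvPolynomial.eval (fun J => chartCoord L κM J₀ J (w + ξ • x)) P := by
    filter_upwards [hnear] with ξ hξ using thetaEval_eq_pow_mul_eval_chart L κM hP J₀ hξ
  have hiter : ∀ k, iteratedDeriv k (fun ξ : ℂ => thetaEval L κM P (w + ξ • x)) 0 =
      iteratedDeriv k (fun ξ : ℂ => theta L κM J₀ (w + ξ • x) ^ D *
        MvPolynomial.eval (fun J => chartCoord L κM J₀ J (w + ξ • x)) P) 0 :=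
    fun k => heq.iteratedDeriv_eq k
  simp only [hiter]
  have hpow : AnalyticAt ℂ (fun ξ : ℂ => theta L κM J₀ (w + ξ • x) ^ D) 0 :=
    (analyticAt_theta_line L κM J₀ w x 0).pow D
  exact forall_iteratedDeriv_mul_eq_zero_iff (analyticAt_eval_chart_line L κM P J₀ w x h0)
    hpow (pow_ne_zero _ h0) N

end Std

end GaGmE

end Literature.NumberTheory.Transcendental

end
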